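import Mathlib
import HarnessLib
import Summits.HubbardSuperconductivity.HubbardSuperconductivity.Theses.ChiralWindow
import Summits.HubbardSuperconductivity.HubbardSuperconductivity.Theorems.WeakCouplingBCSWcbcsKohnLuttingerB1gReduction
import Summits.HubbardSuperconductivity.HubbardSuperconductivity.Theorems.ChiralWindowCwKLChiralWindowGradient
import Summits.HubbardSuperconductivity.HubbardSuperconductivity.Theorems.ChiralWindowCwKLChiralWindowMuWindow
import Summits.HubbardSuperconductivity.HubbardSuperconductivity.Theorems.ChiralWindowCwKLChiralWindowHausdorffFinite
import Summits.HubbardSuperconductivity.HubbardSuperconductivity.Theorems.ChiralWindowCwKLChiralWindowFiniteMeasure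
import Summits.HubbardSuperconductivity.HubbardSuperconductivity.Theorems.ChiralWindowCwKLChiralWindowD4Invariant
import Summits.HubbardSuperconductivity.HubbardSuperconductivity.Theorems.ChiralWindowCwKLChiralWindowMeanZero

/-!
# Crux `CwKLChiralWindow` (stmt-HubbardSuperconductivity-1741): reduction to a `U`-free certificate

Route `HubbardSuperconductivity/ChiralWindow`, rank-3 crux (certified Kohn–Luttinger chiral-window data).
Write `ε₀ = squareDispersion 1 0`, `μ_δ = chemicalPotentialOfDensity ε₀ (1-δ)`, `σ_δ = fermiCurveMeasure ε₀ μ_δ`,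
`χ₀ = lindhardFunction ε₀ μ_δ`, `Λ_U(δ,χ) = channelInf ε₀ μ_δ U χ` (bottom of `⟨ψ, (U + U²χ₀(k+k')) ψ⟩` over
normalised gap functions of the irrep `χ` in `L²(σ_δ)`).

Main result `cwKLChiralWindow_of_certificate`: the crux `CwKLChiralWindow` follows from
* (B) a bound `|χ₀(k + k')| ≤ C_δ` for `k, k'` on the Fermi curve, for every `δ` in the doping window
  `[3/10, 12/25]` (pure analysis: the `t' = 0` Fermi curve is strictly convex there, so `χ₀` has only
  one-sided square-root Kohn edges), and
* (C) the CERTIFICATE at the single coupling `U = 1`: a partner `χs ∉ {B1g, A2g, A1g}`, a window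
  `[a,b] ⊆ [3/10, 12/25]`, margins `γ, c > 0` with clauses (i)–(iii) of the crux for `Λ_1` and the node
  covering (iv) for bottom states at `U = 1` (certified numerics; expected `χs = E`, `|δ - 0.4124| ≲ 2·10⁻⁴`,
  `γ ≈ 10⁻⁴`, SimkovicEtAl2016 §3.1 for the non-rigorous phase diagram),
with the crux's `U₁ = 1`.  MECHANISM (the frame): on the window `μ_δ ∈ (-4,0)` (`stub_klMuWindow`), so `σ_δ`
is finite (`stub_klFiniteMeasure` from `stub_klGradient`, `stub_klHausdorffFinite`) and `D₄`-invariant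
(`stub_klD4Invariant`), hence every gap function of a channel `χ ≠ A1g` has `∫ψ dσ = 0` (`stub_klMeanZero`)
and the bare-`U` term of the kernel drops: `Λ_U(δ,χ) = U² Λ_1(δ,χ)` EXACTLY (`kl_channelInf_sq_of_meanZero`),
while for every channel (used for `A1g`) the bare term is a non-negative penalty and
`U² Λ_1(δ,χ) ≤ Λ_U(δ,χ)` for `0 < U ≤ 1` (`kl_sq_channelInf_one_le`; the `U = 1` image set is bounded below by
`kl_secondOrder_lower`).  Minimisers are `U`-free on mean-zero channels (`kl_pairingForm_sq`), which
transfers (iv).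

References: S. Raghu, S. A. Kivelson, D. J. Scalapino, Phys. Rev. B 81 (2010) 224505 (arXiv:1002.0591)
§II (7), (13); F. Šimkovic et al., Phys. Rev. B 94 (2016) 085106 (arXiv:1512.04271) §3.1.
-/

noncomputable section

set_option linter.dupNamespace false

namespace Summit.HubbardSuperconductivity.HubbardSuperconductivity.Theorems

open MeasureTheory Literature.MathematicalPhysics.QuantumLattice
open Summit.HubbardSuperconductivity.HubbardSuperconductivity.Theses.ChiralWindow
open scoped Pointwise

/-! ### Frame lemmas (general band `ε`, chemical potential `μ`) -/

variable {ε : Momentum → ℝ} {μ : ℝ}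

/-- `2|x| ≤ 1 + x²`. [folklore] -/
theorem kl_two_mul_abs_le (x : ℝ) : 2 * |x| ≤ 1 + x ^ 2 := by
  rcases le_or_gt 0 x with h | h
  · rw [abs_of_nonneg h]; nlinarith [sq_nonneg (x - 1)]
  · rw [abs_of_neg h]; nlinarith [sq_nonneg (x + 1)]

/-- On a finite Fermi-curve measure a normalised gap function has `∫|ψ| dσ ≤ (σ(F) + 1)/2`
(pointwise `2|ψ| ≤ 1 + ψ²`). [folklore] -/
theorem kl_integral_abs_le (hfin : IsFiniteMeasure (fermiCurveMeasure ε μ)) {ψ : Momentum → ℝ}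
    (hψ : MemLp ψ 2 (fermiCurveMeasure ε μ)) (h1 : ∫ k, ψ k ^ 2 ∂fermiCurveMeasure ε μ = 1) :
    ∫ k, |ψ k| ∂fermiCurveMeasure ε μ ≤ ((fermiCurveMeasure ε μ).real Set.univ + 1) / 2 := by
  set σ := fermiCurveMeasure ε μ with hσ
  have hsq : Integrable (fun k => ψ k ^ 2) σ := hψ.integrable_sq
  have hrhs : Integrable (fun k => (1 + ψ k ^ 2) / 2) σ :=
    ((integrable_const (1:ℝ)).add hsq).div_const 2
  have hmono : ∫ k, |ψ k| ∂σ ≤ ∫ k, (1 + ψ k ^ 2) / 2 ∂σ := by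
    refine integral_mono_of_nonneg (Filter.Eventually.of_forall fun k => abs_nonneg _) hrhs ?_
    exact Filter.Eventually.of_forall fun k => by
      have := kl_two_mul_abs_le (ψ k)
      simp only
      linarith
  have hval : ∫ k, (1 + ψ k ^ 2) / 2 ∂σ = (σ.real Set.univ + 1) / 2 := by
    rw [integral_div, integral_add (integrable_const _) hsq, h1, integral_const, smul_eq_mul, mul_one]
  linarith

/-- **Lower bound on the Lindhard (second-order) form** on normalised gap functions: with `|χ₀| ≤ C`
on `F + F` and `σ` finite, `Q(ψ) = ∫∫ ψ(k) χ₀(k+k') ψ(k') dσ dσ ≥ -C ((σ(F)+1)/2)²`.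
[cite: RaghuKivelsonScalapino2010, §II (7)] -/
theorem kl_secondOrder_lower (hε : Measurable ε) {C : ℝ} (hC : 0 ≤ C)
    (hfin : IsFiniteMeasure (fermiCurveMeasure ε μ))
    (hbdd : ∀ k ∈ fermiCurve ε μ, ∀ k' ∈ fermiCurve ε μ, |lindhardFunction ε μ (k + k')| ≤ C)
    {ψ : Momentum → ℝ} (hψ : MemLp ψ 2 (fermiCurveMeasure ε μ))
    (h1 : ∫ k, ψ k ^ 2 ∂fermiCurveMeasure ε μ = 1) :
    -(C * (((fermiCurveMeasure ε μ).real Set.univ + 1) / 2) ^ 2) ≤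
      ∫ k, ψ k * ∫ k', lindhardFunction ε μ (k + k') * ψ k' ∂fermiCurveMeasure ε μ
        ∂fermiCurveMeasure ε μ := by
  set σ := fermiCurveMeasure ε μ with hσ
  set M : ℝ := (σ.real Set.univ + 1) / 2 with hM
  have hψ1 : Integrable ψ σ := hψ.integrable one_le_two
  set g : Momentum → ℝ := fun k => ∫ k', lindhardFunction ε μ (k + k') * ψ k' ∂σ with hg
  have hF : AEStronglyMeasurable
      (fun z : Momentum × Momentum => lindhardFunction ε μ (z.1 + z.2) * ψ z.2) (σ.prod σ) :=
    ((measurable_lindhardFunction hε μ).comp measurable_add).aestronglyMeasurable.mul hψ.1.comp_snd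
  have hg_meas : AEStronglyMeasurable g σ := hF.integral_prod_right'
  have hI : 0 ≤ ∫ k', |ψ k'| ∂σ := integral_nonneg fun _ => abs_nonneg _
  have hIM : ∫ k', |ψ k'| ∂σ ≤ M := kl_integral_abs_le hfin hψ h1
  have hg_bdd : ∀ᵐ k ∂σ, ‖g k‖ ≤ C * ∫ k', ‖ψ k'‖ ∂σ := by
    filter_upwards [ae_mem_fermiCurve hε μ] with k hk
    rw [hg]
    calc ‖∫ k', lindhardFunction ε μ (k + k') * ψ k' ∂σ‖
        ≤ ∫ k', ‖lindhardFunction ε μ (k + k') * ψ k'‖ ∂σ := norm_integral_le_integral_norm _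
      _ ≤ ∫ k', C * ‖ψ k'‖ ∂σ := by
          refine integral_mono_ae (hψ1.bdd_mul (c := C)
            ((measurable_lindhardFunction hε μ).comp (measurable_const_add k)).aestronglyMeasurable
            ?_).norm (hψ1.norm.const_mul C) ?_
          · filter_upwards [ae_mem_fermiCurve hε μ] with k' hk'
            rw [Real.norm_eq_abs]; exact hbdd k hk k' hk'
          · filter_upwards [ae_mem_fermiCurve hε μ] with k' hk'
            rw [norm_mul, Real.norm_eq_abs]
            exact mul_le_mul_of_nonneg_right (hbdd k hk k' hk') (norm_nonneg _)
      _ = C * ∫ k', ‖ψ k'‖ ∂σ := integral_const_mul _ _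
  have hψg : Integrable (fun k => ψ k * g k) σ := hψ1.mul_bdd hg_meas hg_bdd
  -- pointwise a.e. lower bound `ψ k * g k ≥ -(C ∫|ψ|) |ψ k|`
  have hpt : ∀ᵐ k ∂σ, -(C * ∫ k', |ψ k'| ∂σ) * |ψ k| ≤ ψ k * g k := by
    filter_upwards [hg_bdd] with k hk
    have hk' : |g k| ≤ C * ∫ k', |ψ k'| ∂σ := by
      simpa only [Real.norm_eq_abs] using hk
    have h2 : |ψ k * g k| ≤ |ψ k| * (C * ∫ k', |ψ k'| ∂σ) := by
      rw [abs_mul]; exact mul_le_mul_of_nonneg_left hk' (abs_nonneg _)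
    have h3 := neg_abs_le (ψ k * g k)
    nlinarith
  have hlow : ∫ k, -(C * ∫ k', |ψ k'| ∂σ) * |ψ k| ∂σ ≤ ∫ k, ψ k * g k ∂σ :=
    integral_mono_ae ((hψ1.abs).const_mul _) hψg hpt
  rw [integral_const_mul] at hlow
  have hsq : (∫ k', |ψ k'| ∂σ) * ∫ k', |ψ k'| ∂σ ≤ M ^ 2 := by
    rw [sq]; exact mul_le_mul hIM hIM hI (le_trans hI hIM)
  have : -(C * M ^ 2) ≤ -(C * ∫ k', |ψ k'| ∂σ) * ∫ k, |ψ k| ∂σ := by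
    have := mul_le_mul_of_nonneg_left hsq hC
    nlinarith
  exact le_trans this hlow

/-- **`U²`-homogeneity of the channel bottom off `A1g`.** If every state of the channel `χ` has
vanishing mean (automatic for `χ ≠ A1g` on a `D₄`-invariant Fermi curve), then
`channelInf ε μ U χ = U² · channelInf ε μ 1 χ` for EVERY `U` (no lower bound needed: `sInf (c • S) =
c • sInf S` for `c ≥ 0` holds with the junk conventions). [cite: RaghuKivelsonScalapino2010, §II (7)] -/
theorem kl_channelInf_sq_of_meanZero (hε : Measurable ε) {C : ℝ} (U : ℝ) (χ : D4Irrep)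
    (hfin : IsFiniteMeasure (fermiCurveMeasure ε μ))
    (hbdd : ∀ k ∈ fermiCurve ε μ, ∀ k' ∈ fermiCurve ε μ, |lindhardFunction ε μ (k + k')| ≤ C)
    (hmean : ∀ ψ, IsChannelState ε μ χ ψ → ∫ k, ψ k ∂fermiCurveMeasure ε μ = 0) :
    channelInf ε μ U χ = U ^ 2 * channelInf ε μ 1 χ := by
  unfold channelInf
  have himg : (pairingForm ε μ U) '' {ψ | IsChannelState ε μ χ ψ}
      = (U ^ 2) • ((pairingForm ε μ 1) '' {ψ | IsChannelState ε μ χ ψ}) := by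
    rw [← Set.image_smul, Set.image_image]
    apply Set.image_congr
    intro ψ hψ
    have h0 := hmean ψ hψ
    show pairingForm ε μ U ψ = U ^ 2 • pairingForm ε μ 1 ψ
    rw [pairingForm_eq_first_add_second hε U hfin hψ.1 hbdd,
      pairingForm_eq_first_add_second hε 1 hfin hψ.1 hbdd, h0, smul_eq_mul]
    ring
  rw [himg, Real.sInf_smul_of_nonneg (sq_nonneg U), smul_eq_mul]

/-- **The bare-`U` penalty.** For `0 < U ≤ 1` and any channel (used for `A1g`),
`U² · channelInf ε μ 1 χ ≤ channelInf ε μ U χ`: state by state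
`U (∫ψ)² + U² Q(ψ) ≥ U² ((∫ψ)² + Q(ψ))`, and the `U = 1` image set is bounded below by
`kl_secondOrder_lower`. [cite: RaghuKivelsonScalapino2010, §II (7)] -/
theorem kl_sq_channelInf_one_le (hε : Measurable ε) {C U : ℝ} (hC : 0 ≤ C) (hU0 : 0 < U) (hU1 : U ≤ 1)
    (χ : D4Irrep) (hfin : IsFiniteMeasure (fermiCurveMeasure ε μ))
    (hbdd : ∀ k ∈ fermiCurve ε μ, ∀ k' ∈ fermiCurve ε μ, |lindhardFunction ε μ (k + k')| ≤ C) :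
    U ^ 2 * channelInf ε μ 1 χ ≤ channelInf ε μ U χ := by
  unfold channelInf
  set S := {ψ | IsChannelState ε μ χ ψ} with hS
  rcases (pairingForm ε μ U '' S).eq_empty_or_nonempty with hSe | hSne
  · have hSe' : pairingForm ε μ 1 '' S = ∅ := by
      rw [Set.image_eq_empty] at hSe ⊢; exact hSe
    rw [hSe, hSe', Real.sInf_empty, mul_zero]
  · have hbb : BddBelow (pairingForm ε μ 1 '' S) := by
      refine ⟨-(C * (((fermiCurveMeasure ε μ).real Set.univ + 1) / 2) ^ 2), ?_⟩
      rintro x ⟨ψ, hψ, rfl⟩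
      rw [pairingForm_eq_first_add_second hε 1 hfin hψ.1 hbdd]
      have := kl_secondOrder_lower hε hC hfin hbdd hψ.1 hψ.2.1
      nlinarith [sq_nonneg (∫ k, ψ k ∂fermiCurveMeasure ε μ)]
    refine le_csInf hSne ?_
    rintro x ⟨ψ, hψ, rfl⟩
    have hle : sInf (pairingForm ε μ 1 '' S) ≤ pairingForm ε μ 1 ψ := csInf_le hbb ⟨ψ, hψ, rfl⟩
    have hUU : U ^ 2 ≤ U := by nlinarith
    rw [pairingForm_eq_first_add_second hε U hfin hψ.1 hbdd]
    rw [pairingForm_eq_first_add_second hε 1 hfin hψ.1 hbdd] at hle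
    have hI := sq_nonneg (∫ k, ψ k ∂fermiCurveMeasure ε μ)
    have h1 : U ^ 2 * sInf (pairingForm ε μ 1 '' S) ≤
        U ^ 2 * (1 * (∫ k, ψ k ∂fermiCurveMeasure ε μ) ^ 2 + 1 ^ 2 *
          ∫ k, ψ k * ∫ k', lindhardFunction ε μ (k + k') * ψ k' ∂fermiCurveMeasure ε μ
            ∂fermiCurveMeasure ε μ) := mul_le_mul_of_nonneg_left hle (sq_nonneg U)
    nlinarith [mul_le_mul_of_nonneg_right hUU hI]

/-- **`U²`-homogeneity of the pairing form on a mean-zero gap function.**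
[cite: RaghuKivelsonScalapino2010, §II (7)] -/
theorem kl_pairingForm_sq (hε : Measurable ε) {C : ℝ} (U : ℝ)
    (hfin : IsFiniteMeasure (fermiCurveMeasure ε μ))
    (hbdd : ∀ k ∈ fermiCurve ε μ, ∀ k' ∈ fermiCurve ε μ, |lindhardFunction ε μ (k + k')| ≤ C)
    {ψ : Momentum → ℝ} (hψ : MemLp ψ 2 (fermiCurveMeasure ε μ))
    (h0 : ∫ k, ψ k ∂fermiCurveMeasure ε μ = 0) :
    pairingForm ε μ U ψ = U ^ 2 * pairingForm ε μ 1 ψ := by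
  rw [pairingForm_eq_first_add_second hε U hfin hψ hbdd,
    pairingForm_eq_first_add_second hε 1 hfin hψ hbdd, h0]
  ring

/-- `min (c·x) (c·y) ≤ c · min x y`. [folklore] -/
theorem kl_min_mul_le (c x y : ℝ) : min (c * x) (c * y) ≤ c * min x y := by
  rcases le_total x y with h | h
  · rw [min_eq_left h]; exact min_le_left _ _
  · rw [min_eq_right h]; exact min_le_right _ _

/-! ### The reduction -/

/-- **`CwKLChiralWindow` from a `U`-free certificate.**  Hypotheses: (B) for every `δ` in the doping
window a bound `C` on `|χ₀(k+k')|` over the Fermi curve; (C) the certificate at `U = 1` — a partner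
`χs ∉ {B1g, A2g, A1g}`, `3/10 ≤ a < b ≤ 12/25`, `γ, c > 0`, (i) `Λ_1(a,B1g) + γ ≤ Λ_1(a,χ)` for `χ ≠ B1g`,
(ii) `Λ_1(b,χs) + γ ≤ Λ_1(b,χ)` for `χ ≠ χs`, (iii) `min(Λ_1(δ,B1g), Λ_1(δ,χs)) + γ ≤ Λ_1(δ,χ)` for
`δ ∈ [a,b]`, `χ ∉ {B1g, χs}`, (iv) node covering by bottom states at `U = 1` on `[a,b]`.  Conclusion: the
crux, with the same `χs, a, b, γ, c` and `U₁ = 1`.  [cite: RaghuKivelsonScalapino2010, §II (7) and (13)] -/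
theorem cwKLChiralWindow_of_certificate :
    (∀ δ ∈ Set.Icc (3/10 : ℝ) (12/25), ∃ C : ℝ,
      ∀ k ∈ fermiCurve (squareDispersion 1 0) (chemicalPotentialOfDensity (squareDispersion 1 0) (1 - δ)),
      ∀ k' ∈ fermiCurve (squareDispersion 1 0) (chemicalPotentialOfDensity (squareDispersion 1 0) (1 - δ)),
        |lindhardFunction (squareDispersion 1 0) (chemicalPotentialOfDensity (squareDispersion 1 0) (1 - δ)) (k + k')| ≤ C) →
    (∃ χs : D4Irrep, χs ≠ D4Irrep.B1g ∧ χs ≠ D4Irrep.A2g ∧ χs ≠ D4Irrep.A1g ∧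
    ∃ a b γ c : ℝ, 3/10 ≤ a ∧ a < b ∧ b ≤ 12/25 ∧ 0 < γ ∧ 0 < c ∧
    (∀ χ, χ ≠ D4Irrep.B1g →
      channelInf (squareDispersion 1 0) (chemicalPotentialOfDensity (squareDispersion 1 0) (1 - a)) 1 D4Irrep.B1g + γ ≤
        channelInf (squareDispersion 1 0) (chemicalPotentialOfDensity (squareDispersion 1 0) (1 - a)) 1 χ) ∧
    (∀ χ, χ ≠ χs →
      channelInf (squareDispersion 1 0) (chemicalPotentialOfDensity (squareDispersion 1 0) (1 - b)) 1 χs + γ ≤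
        channelInf (squareDispersion 1 0) (chemicalPotentialOfDensity (squareDispersion 1 0) (1 - b)) 1 χ) ∧
    (∀ δ ∈ Set.Icc a b, ∀ χ, χ ≠ D4Irrep.B1g → χ ≠ χs →
      min (channelInf (squareDispersion 1 0) (chemicalPotentialOfDensity (squareDispersion 1 0) (1 - δ)) 1 D4Irrep.B1g)
          (channelInf (squareDispersion 1 0) (chemicalPotentialOfDensity (squareDispersion 1 0) (1 - δ)) 1 χs) + γ ≤
        channelInf (squareDispersion 1 0) (chemicalPotentialOfDensity (squareDispersion 1 0) (1 - δ)) 1 χ) ∧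
    (∀ δ ∈ Set.Icc a b, ∃ (g : Momentum → ℝ) (n : ℕ) (f : Fin n → Momentum → ℝ),
      IsChannelState (squareDispersion 1 0) (chemicalPotentialOfDensity (squareDispersion 1 0) (1 - δ)) D4Irrep.B1g g ∧
      pairingForm (squareDispersion 1 0) (chemicalPotentialOfDensity (squareDispersion 1 0) (1 - δ)) 1 g =
        channelInf (squareDispersion 1 0) (chemicalPotentialOfDensity (squareDispersion 1 0) (1 - δ)) 1 D4Irrep.B1g ∧
      (∀ i, IsChannelState (squareDispersion 1 0) (chemicalPotentialOfDensity (squareDispersion 1 0) (1 - δ)) χs (f i) ∧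
        pairingForm (squareDispersion 1 0) (chemicalPotentialOfDensity (squareDispersion 1 0) (1 - δ)) 1 (f i) =
          channelInf (squareDispersion 1 0) (chemicalPotentialOfDensity (squareDispersion 1 0) (1 - δ)) 1 χs) ∧
      (Pairwise fun i j => ∫ k, f i k * f j k
        ∂fermiCurveMeasure (squareDispersion 1 0) (chemicalPotentialOfDensity (squareDispersion 1 0) (1 - δ)) = 0) ∧
      ∀ᵐ k ∂fermiCurveMeasure (squareDispersion 1 0) (chemicalPotentialOfDensity (squareDispersion 1 0) (1 - δ)),
        c ≤ g k ^ 2 + ∑ i, f i k ^ 2)) →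
    CwKLChiralWindow := by
  intro hB hCert
  obtain ⟨χs, hsB1, hsA2, hsA1, a, b, γ, c, ha, hab, hb, hγ, hc, hi, hii, hiii, hiv⟩ := hCert
  have hε : Measurable (squareDispersion 1 0) := measurable_squareDispersion 1 0
  have hwin : ∀ δ ∈ Set.Icc a b, δ ∈ Set.Icc (3/10:ℝ) (12/25) :=
    fun δ hδ => ⟨le_trans ha hδ.1, le_trans hδ.2 hb⟩
  have hμ : ∀ δ ∈ Set.Icc a b,
      chemicalPotentialOfDensity (squareDispersion 1 0) (1 - δ) ∈ Set.Ioo (-4:ℝ) 0 :=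
    fun δ hδ => stub_klMuWindow δ (hwin δ hδ)
  have hfin : ∀ δ ∈ Set.Icc a b, IsFiniteMeasure
      (fermiCurveMeasure (squareDispersion 1 0) (chemicalPotentialOfDensity (squareDispersion 1 0) (1 - δ))) :=
    fun δ hδ => stub_klFiniteMeasure stub_klGradient stub_klHausdorffFinite _ (hμ δ hδ)
  have hinv : ∀ δ ∈ Set.Icc a b, ∀ γ' : DihedralGroup 4, MeasurePreserving (d4Momentum γ')
      (fermiCurveMeasure (squareDispersion 1 0) (chemicalPotentialOfDensity (squareDispersion 1 0) (1 - δ)))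
      (fermiCurveMeasure (squareDispersion 1 0) (chemicalPotentialOfDensity (squareDispersion 1 0) (1 - δ))) :=
    fun δ hδ => stub_klD4Invariant stub_klGradient _ (hμ δ hδ)
  have hmean : ∀ δ ∈ Set.Icc a b, ∀ (χ : D4Irrep) (ψ : Momentum → ℝ), χ ≠ D4Irrep.A1g →
      IsChannelState (squareDispersion 1 0) (chemicalPotentialOfDensity (squareDispersion 1 0) (1 - δ)) χ ψ →
      ∫ k, ψ k ∂fermiCurveMeasure (squareDispersion 1 0)
        (chemicalPotentialOfDensity (squareDispersion 1 0) (1 - δ)) = 0 :=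
    fun δ hδ χ ψ hχ hψ => (stub_klMeanZero _ _ (hfin δ hδ) (hinv δ hδ) χ ψ hχ hψ).2
  -- the three consequences of the frame, per doping (the bound `C` is existential in (B))
  have hhom : ∀ δ ∈ Set.Icc a b, ∀ (U : ℝ) (χ : D4Irrep), χ ≠ D4Irrep.A1g →
      channelInf (squareDispersion 1 0) (chemicalPotentialOfDensity (squareDispersion 1 0) (1 - δ)) U χ =
        U ^ 2 * channelInf (squareDispersion 1 0) (chemicalPotentialOfDensity (squareDispersion 1 0) (1 - δ)) 1 χ := by
    intro δ hδ U χ hχ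
    obtain ⟨C, hC⟩ := hB δ (hwin δ hδ)
    exact kl_channelInf_sq_of_meanZero hε U χ (hfin δ hδ) hC (fun ψ hψ => hmean δ hδ χ ψ hχ hψ)
  have hpen : ∀ δ ∈ Set.Icc a b, ∀ U ∈ Set.Ioo (0:ℝ) 1, ∀ χ : D4Irrep,
      U ^ 2 * channelInf (squareDispersion 1 0) (chemicalPotentialOfDensity (squareDispersion 1 0) (1 - δ)) 1 χ ≤
        channelInf (squareDispersion 1 0) (chemicalPotentialOfDensity (squareDispersion 1 0) (1 - δ)) U χ := by
    intro δ hδ U hU χ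
    obtain ⟨C, hC⟩ := hB δ (hwin δ hδ)
    have hC' : ∀ k ∈ fermiCurve (squareDispersion 1 0) (chemicalPotentialOfDensity (squareDispersion 1 0) (1 - δ)),
        ∀ k' ∈ fermiCurve (squareDispersion 1 0) (chemicalPotentialOfDensity (squareDispersion 1 0) (1 - δ)),
        |lindhardFunction (squareDispersion 1 0)
          (chemicalPotentialOfDensity (squareDispersion 1 0) (1 - δ)) (k + k')| ≤ max C 0 :=
      fun k hk k' hk' => le_trans (hC k hk k' hk') (le_max_left _ _)
    exact kl_sq_channelInf_one_le hε (le_max_right _ _) hU.1 hU.2.le χ (hfin δ hδ) hC'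
  have hform : ∀ δ ∈ Set.Icc a b, ∀ (U : ℝ) (χ : D4Irrep) (ψ : Momentum → ℝ), χ ≠ D4Irrep.A1g →
      IsChannelState (squareDispersion 1 0) (chemicalPotentialOfDensity (squareDispersion 1 0) (1 - δ)) χ ψ →
      pairingForm (squareDispersion 1 0) (chemicalPotentialOfDensity (squareDispersion 1 0) (1 - δ)) U ψ =
        U ^ 2 * pairingForm (squareDispersion 1 0) (chemicalPotentialOfDensity (squareDispersion 1 0) (1 - δ)) 1 ψ := by
    intro δ hδ U χ ψ hχ hψ
    obtain ⟨C, hC⟩ := hB δ (hwin δ hδ)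
    exact kl_pairingForm_sq hε U (hfin δ hδ) hC hψ.1 (hmean δ hδ χ ψ hχ hψ)
  have haI : a ∈ Set.Icc a b := Set.left_mem_Icc.2 hab.le
  have hbI : b ∈ Set.Icc a b := Set.right_mem_Icc.2 hab.le
  refine ⟨χs, hsB1, hsA2, a, b, γ, c, 1, ha, hab, hb, hγ, hc, one_pos, ?_⟩
  intro U hU
  have hU2 : 0 ≤ U ^ 2 := sq_nonneg U
  refine ⟨?_, ?_, ?_, ?_⟩
  · -- (i) at δ = a
    intro χ hχ
    show channelInf (squareDispersion 1 0) (chemicalPotentialOfDensity (squareDispersion 1 0) (1 - a)) U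
        D4Irrep.B1g + γ * U ^ 2 ≤
      channelInf (squareDispersion 1 0) (chemicalPotentialOfDensity (squareDispersion 1 0) (1 - a)) U χ
    rw [hhom a haI U D4Irrep.B1g (by decide)]
    have h1 := mul_le_mul_of_nonneg_left (hi χ hχ) hU2
    have h2 := hpen a haI U hU χ
    nlinarith
  · -- (ii) at δ = b
    intro χ hχ
    show channelInf (squareDispersion 1 0) (chemicalPotentialOfDensity (squareDispersion 1 0) (1 - b)) U χs
        + γ * U ^ 2 ≤
      channelInf (squareDispersion 1 0) (chemicalPotentialOfDensity (squareDispersion 1 0) (1 - b)) U χ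
    rw [hhom b hbI U χs hsA1]
    have h1 := mul_le_mul_of_nonneg_left (hii χ hχ) hU2
    have h2 := hpen b hbI U hU χ
    nlinarith
  · -- (iii) isolation on [a, b]
    intro δ hδ χ hχ1 hχ2
    show min (channelInf (squareDispersion 1 0) (chemicalPotentialOfDensity (squareDispersion 1 0) (1 - δ)) U
          D4Irrep.B1g)
        (channelInf (squareDispersion 1 0) (chemicalPotentialOfDensity (squareDispersion 1 0) (1 - δ)) U χs)
        + γ * U ^ 2 ≤
      channelInf (squareDispersion 1 0) (chemicalPotentialOfDensity (squareDispersion 1 0) (1 - δ)) U χ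
    rw [hhom δ hδ U D4Irrep.B1g (by decide), hhom δ hδ U χs hsA1]
    have h1 := mul_le_mul_of_nonneg_left (hiii δ hδ χ hχ1 hχ2) hU2
    have h2 := hpen δ hδ U hU χ
    have h3 := kl_min_mul_le (U ^ 2) (channelInf (squareDispersion 1 0)
      (chemicalPotentialOfDensity (squareDispersion 1 0) (1 - δ)) 1 D4Irrep.B1g)
      (channelInf (squareDispersion 1 0)
      (chemicalPotentialOfDensity (squareDispersion 1 0) (1 - δ)) 1 χs)
    nlinarith
  · -- (iv) node covering on [a, b]
    intro δ hδ
    obtain ⟨g, n, f, hg, hgval, hf, horth, hcov⟩ := hiv δ hδ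
    refine ⟨g, n, f, hg, ?_, fun i => ⟨(hf i).1, ?_⟩, horth, hcov⟩
    · show pairingForm (squareDispersion 1 0) (chemicalPotentialOfDensity (squareDispersion 1 0) (1 - δ)) U g =
        channelInf (squareDispersion 1 0) (chemicalPotentialOfDensity (squareDispersion 1 0) (1 - δ)) U D4Irrep.B1g
      rw [hform δ hδ U D4Irrep.B1g g (by decide) hg, hgval, hhom δ hδ U D4Irrep.B1g (by decide)]
    · show pairingForm (squareDispersion 1 0) (chemicalPotentialOfDensity (squareDispersion 1 0) (1 - δ)) U (f i) =
        channelInf (squareDispersion 1 0) (chemicalPotentialOfDensity (squareDispersion 1 0) (1 - δ)) U χs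
      rw [hform δ hδ U χs (f i) hsA1 (hf i).1, (hf i).2, hhom δ hδ U χs hsA1]

end Summit.HubbardSuperconductivity.HubbardSuperconductivity.Theorems

end
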